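import Summits.PneNP.PneNP.Theorems.SymmetryBudgetNoHiddenOrderProgramSymmetric
import Summits.PneNP.PneNP.Theorems.SymmetryBudgetNoHiddenOrderProgramGatesCard
import Summits.PneNP.PneNP.Theorems.SymmetryBudgetNoHiddenOrderGraphSocket

/-!
# `NoHiddenOrder` (stmt-PneNP-14781), (R2c) VI: the window canoniser program — assembly of the graph-level socket

Route `PneNP/SymmetryBudget`.  Packaging the symmetry data (`…ProgramSymmetric.lean`: `isSym_θw`, `θw_out`) and the size
(`…ProgramGatesCard.lean`: `eventually_size_Gt`) of seat -1's window canoniser program with the graph-level socket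
(`…GraphSocket.lean`: `GraphProgram`, `noHiddenOrder_of_graphProgram`):

* `graphProgramOf P hk hs hsound : GraphProgram m` — ANY `P : SymProg (Fin m × Fin m) (Gt m)` with the dispatch `WCanon.kind/srcs` (the rank
  is free) and GRAPH-LEVEL SOUNDNESS of its output gates is a window graph canoniser (`Λ := Gt m`, `out := Gt.out`, `θ := θw m`);
* **`noHiddenOrder_of_programs`** — if for all large `m` such a `P` with graph-level soundness exists, then `NoHiddenOrder`
  (size by `eventually_size_Gt`, polynomial `X ^ 4051`).
So the item closes with: a rank making `⟨kind, srcs, rank, rank_lt⟩` a `SymProg` (seat -1's `…ProgramRank*.lean`), and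
`sound : ∀ x, ∃ ρ ∈ Bud, fromRel (P.sem x ∘ out) = fromRel (x ∘ ρ×ρ)` — by `sem_out_eq_outB` (`…ProgramOutSem.lean`) this is
`window_sound_of_good` once the value / refinement modules identify the root value and the root colouring.
Sorry-free; supports stmt-PneNP-14781, does not close it.
-/

set_option linter.dupNamespace false -- `Summit.PneNP.PneNP.…` (D-0017 single-conjunct layout)

namespace Summit.PneNP.PneNP.Theorems

open Finset Filter CGBits BranchSum Literature.Computability.Complexity Literature.Computability.Complexity.SymProg
open Summit.PneNP.PneNP.Theses.SymmetryBudget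

namespace WCanon

variable {m : ℕ}

/-- Graph-level soundness of the output gates of a program on `Gt m`: the output graph is a `Bud`-relabelling of the input graph. [folklore] -/
def GraphSound (P : SymProg (Fin m × Fin m) (Gt m)) : Prop :=
  ∀ x : Fin m × Fin m → Bool, ∃ ρ ∈ pointStabiliserBudget m (Nat.log 2 m),
    (SimpleGraph.fromRel fun u v => P.sem x (Gt.out (u, v)) = true) = SimpleGraph.fromRel fun u v => x (ρ u, ρ v) = true

/-- **A program with the dispatch `kind/srcs` and graph-level sound outputs is a window graph canoniser** (`GraphProgram m`), with the
symmetry data `θw m`. [folklore] -/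
noncomputable def graphProgramOf (P : SymProg (Fin m × Fin m) (Gt m)) (hk : ∀ l, P.kind l = kind l) (hs : ∀ l, P.srcs l = srcs l)
    (hsound : GraphSound P) : GraphProgram m where
  Λ := Gt m
  P := P
  out := Gt.out
  θ := θw m
  isSym _ hρ := isSym_θw hρ P hk hs
  out_fixed ρ _ q := θw_out ρ q
  sound := hsound

/-- The gate type of the packaged program is `Gt m`. -/
theorem card_graphProgramOf (P : SymProg (Fin m × Fin m) (Gt m)) (hk : ∀ l, P.kind l = kind l) (hs : ∀ l, P.srcs l = srcs l)
    (hsound : GraphSound P) : Fintype.card (graphProgramOf P hk hs hsound).Λ = Fintype.card (Gt m) := rfl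

/-- **`NoHiddenOrder` from the programs**: if for all large `m` there is a program on `Gt m` with the dispatch `kind/srcs` (any rank) whose output
gates are graph-level sound, then `NoHiddenOrder`. [folklore] -/
theorem noHiddenOrder_of_programs
    (h : ∀ᶠ m : ℕ in atTop, ∃ P : SymProg (Fin m × Fin m) (Gt m), (∀ l, P.kind l = kind l) ∧ (∀ l, P.srcs l = srcs l) ∧ GraphSound P) :
    NoHiddenOrder := by
  refine noHiddenOrder_of_graphProgram (Polynomial.X ^ 4051) ((h.and eventually_size_Gt).mono fun m hm => ?_)
  obtain ⟨⟨P, hk, hs, hsound⟩, hsize⟩ := hm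
  exact ⟨graphProgramOf P hk hs hsound, hsize⟩

end WCanon

end Summit.PneNP.PneNP.Theorems
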